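import Mathlib.Analysis.SpecialFunctions.Pow.Real
import Mathlib.Tactic
import HarnessLib

/-!
# Two-block (bi-exchangeable) pattern laws: the coverage square (X-2D) and the MTP₂ square

Support file for the Sahi / Conjecture-P programme of route `PercNearOneGluingNoHeavy`
(`--supports stmt-CriticalPhenomena-4575`, prover prim-l12-p5 gen 24; proof note
`prim-l12-p5/FRESH-CYCLE-g24.md` §5, Proposition 5.1 and the factorisation of the MTP₂ square).
Companions: `…LowerTailSpecialPointGrid`, `…LowerTailSpecialPointGridFKG`.  No definitions, no sorries.

For a law invariant under `Sym(O₁) × Sym(O₂)` write `A = X(a₁,a₂)` for the coverage value of a set with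
`aᵢ` points in block `i`, `δᵢ` for the fresh mass of a new block-`i` point (`X(A + qᵢ) = A + δᵢ`), and
`η = P(Z ∩ A = ∅, q₁ ∈ Z, q₂ ∈ Z)` (`X(A + q₁ + q₂) = A + δ₁ + δ₂ − η`, `0 ≤ η ≤ min(δ₁,δ₂)`); building `A`
point by point gives `A ≥ a₁δ₁ + a₂δ₂`.  Then (`x_ineq_2d`)
`s·X(a₁+1,a₂)·X(a₁,a₂+1) ≤ (s+1)·X(a₁+1,a₂+1)·X(a₁,a₂)` with `s = a₁ + a₂`: the coefficient array of the
two-sorted cycle series is TP₂.  `mtp2_square` multiplies this with the (conjectured, note §5) mixed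
log-supermodularity of the partition function to give the MTP₂ square of the block-count law of the cycle of
a point, which by FKG on the grid gives GC-FINER for bi-exchangeable laws (Theorem 5.2 of the note reduces
everything to that one log-supermodularity).
-/

namespace Summit.CriticalPhenomena.PercolationContinuityZ3.Theorems

namespace TwoBlockSquare

/-- The ordered case `δ₁ ≤ δ₂` of the coverage square. -/
theorem x_ineq_2d_of_le (a₁ a₂ A δ₁ δ₂ η : ℝ) (ha₁ : 0 ≤ a₁) (ha₂ : 0 ≤ a₂) (hA : a₁ * δ₁ + a₂ * δ₂ ≤ A)
    (hδ₁ : 0 ≤ δ₁) (h12 : δ₁ ≤ δ₂) (hη : η ≤ δ₁) :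
    (a₁ + a₂) * (A + δ₁) * (A + δ₂) ≤ (a₁ + a₂ + 1) * (A + δ₁ + δ₂ - η) * A := by
  -- A ≥ sδ₁ + a₂ t with t = δ₂ − δ₁ ≥ 0, hence A ≥ 0 and A + δ₂ − s δ₁ ≥ 0
  have ht : 0 ≤ δ₂ - δ₁ := by linarith
  have hL : (a₁ + a₂) * δ₁ + a₂ * (δ₂ - δ₁) ≤ A := by nlinarith
  have hA0 : 0 ≤ A := by nlinarith [mul_nonneg ha₁ hδ₁, mul_nonneg ha₂ (hδ₁.trans h12)]
  -- step 1: replace η by δ₁ (the expression is decreasing in η)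
  have h1 : (a₁ + a₂ + 1) * (A + δ₁ + δ₂ - δ₁) * A ≤ (a₁ + a₂ + 1) * (A + δ₁ + δ₂ - η) * A := by
    have : 0 ≤ (a₁ + a₂ + 1) * A := by positivity
    nlinarith
  -- step 2: at η = δ₁ the difference is A (A + δ₂ − s δ₁) − s δ₁ δ₂ ≥ L (L + δ₂ − s δ₁) − s δ₁ δ₂ ≥ 0
  have hfac : 0 ≤ A + δ₂ - (a₁ + a₂) * δ₁ := by nlinarith
  have h2 : ((a₁ + a₂) * δ₁ + a₂ * (δ₂ - δ₁)) * (((a₁ + a₂) * δ₁ + a₂ * (δ₂ - δ₁)) + δ₂ - (a₁ + a₂) * δ₁)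
      ≤ A * (A + δ₂ - (a₁ + a₂) * δ₁) := by
    have hL0 : 0 ≤ (a₁ + a₂) * δ₁ + a₂ * (δ₂ - δ₁) := by positivity
    exact mul_le_mul hL (by linarith) (by nlinarith) hA0
  have h3 : (a₁ + a₂) * δ₁ * δ₂ ≤
      ((a₁ + a₂) * δ₁ + a₂ * (δ₂ - δ₁)) * (((a₁ + a₂) * δ₁ + a₂ * (δ₂ - δ₁)) + δ₂ - (a₁ + a₂) * δ₁) := by
    nlinarith [mul_nonneg (mul_nonneg ha₂ ht) hδ₁, mul_nonneg (mul_nonneg ha₂ ht) ht,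
      mul_nonneg (mul_nonneg ha₁ hδ₁) (mul_nonneg ha₂ ht), mul_nonneg (mul_nonneg ha₂ hδ₁) (mul_nonneg ha₂ ht),
      mul_nonneg ha₂ (mul_nonneg ha₂ (mul_nonneg ht ht))]
  nlinarith [h1, h2, h3]

/-- **(X-2D), Proposition 5.1 of the note.**  For a bi-exchangeable coverage function, with `s = a₁ + a₂`:
`s · X(a₁+1,a₂) · X(a₁,a₂+1) ≤ (s+1) · X(a₁+1,a₂+1) · X(a₁,a₂)`, in terms of the data
`A = X(a₁,a₂)`, fresh masses `δ₁, δ₂ ≥ 0`, and overlap `η ≤ min(δ₁,δ₂)` (its sign is not needed), using only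
`A ≥ a₁δ₁ + a₂δ₂`. -/
theorem x_ineq_2d (a₁ a₂ A δ₁ δ₂ η : ℝ) (ha₁ : 0 ≤ a₁) (ha₂ : 0 ≤ a₂) (hA : a₁ * δ₁ + a₂ * δ₂ ≤ A)
    (hδ₁ : 0 ≤ δ₁) (hδ₂ : 0 ≤ δ₂) (hη₁ : η ≤ δ₁) (hη₂ : η ≤ δ₂) :
    (a₁ + a₂) * (A + δ₁) * (A + δ₂) ≤ (a₁ + a₂ + 1) * (A + δ₁ + δ₂ - η) * A := by
  rcases le_total δ₁ δ₂ with h12 | h21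
  · exact x_ineq_2d_of_le a₁ a₂ A δ₁ δ₂ η ha₁ ha₂ hA hδ₁ h12 hη₁
  · have := x_ineq_2d_of_le a₂ a₁ A δ₂ δ₁ η ha₂ ha₁ (by linarith) hδ₂ h21 hη₂
    have e1 : (a₂ + a₁) * (A + δ₂) * (A + δ₁) = (a₁ + a₂) * (A + δ₁) * (A + δ₂) := by ring
    have e2 : (a₂ + a₁ + 1) * (A + δ₂ + δ₁ - η) * A = (a₁ + a₂ + 1) * (A + δ₁ + δ₂ - η) * A := by ring
    linarith [e1, e2]

/-- **The MTP₂ square factorises.**  With the binomial/factorial constant `c ≥ 0`, the coverage square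
`s X₁₀ X₀₁ ≤ (s+1) X₁₁ X₀₀` (`x_ineq_2d`) and the mixed log-supermodularity of the partition function
`Z₁₀' Z₀₁' ≤ Z₁₁' Z₀₀'` (of the complementary systems) give the MTP₂ square
`ρ(j₁+1,j₂) ρ(j₁,j₂+1) ≤ ρ(j₁+1,j₂+1) ρ(j₁,j₂)` of the block-count law of the cycle of a point. -/
theorem mtp2_square (c s X00 X10 X01 X11 Z00 Z10 Z01 Z11 : ℝ) (hc : 0 ≤ c) (hs : 0 ≤ s)
    (hX10 : 0 ≤ X10) (hX01 : 0 ≤ X01) (hZ10 : 0 ≤ Z10) (hZ01 : 0 ≤ Z01)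
    (hX : s * X10 * X01 ≤ (s + 1) * X11 * X00) (hZ : Z10 * Z01 ≤ Z11 * Z00) :
    (c * s * X10 * Z01) * (c * X01 * Z10) ≤ (c * (s + 1) * X11 * Z00) * (c * X00 * Z11) := by
  have h1 : 0 ≤ s * X10 * X01 := by positivity
  have h2 : 0 ≤ Z10 * Z01 := mul_nonneg hZ10 hZ01
  have h3 := mul_le_mul hX hZ h2 (h1.trans hX)
  have hc2 : 0 ≤ c * c := mul_nonneg hc hc
  have := mul_le_mul_of_nonneg_left h3 hc2
  nlinarith [this]

end TwoBlockSquare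

end Summit.CriticalPhenomena.PercolationContinuityZ3.Theorems
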